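import Literature.NumberTheory.DiophantineGeometry.MultiplicativeGroupApproximationLatticeProofs
import Mathlib.MeasureTheory.Measure.Prod
import Mathlib.MeasureTheory.Constructions.Pi
import Mathlib.Analysis.Convex.Topology
import Mathlib.Algebra.Module.ZLattice.Basic
import HarnessLib

/-!
# Minkowski's second theorem for a norm on `ℝ^q` (Evertse–Győry, Thm 4.3.1, upper bound)

Topic `NumberTheory/DiophantineGeometry`; namespace
`Literature.NumberTheory.DiophantineGeometry.Dioph`.
Second instalment of the geometry of numbers behind Evertse–Győry, *Unit Equations in
Diophantine Number Theory* (2015), Prop. 4.3.4 (see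
`MultiplicativeGroupApproximationLatticeProofs.lean` for the first).

We prove the upper bound in **Minkowski's theorem on successive minima** (Evertse–Győry,
Thm 4.3.1, p. 70; Minkowski 1896) for the unit ball of a norm `N` on `ℝ^q` and the lattice `ℤ^q`,
in the form needed later: if `v₀, …, v_{q−1} ∈ ℤ^q` is a *directional basis* — `v_k` has minimal
norm among the integer vectors outside the real span of `v₀, …, v_{k−1}` — then
`N(v₀) ⋯ N(v_{q−1}) · vol {N < 1} ≤ 2^q`.
The proof is the "squeezing" argument of Tao–Vu, *Additive Combinatorics* (2006), Thm 3.30 /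
Lemma 3.31: starting from `A₀ = (λ_q/2) B` one squeezes `A_{j−1}` fibrewise towards a section of
the coordinate projection by the factor `λ_j/λ_{j+1}` in the first `j` coordinates; the final set
has volume `λ₁⋯λ_q 2^{−q} vol(B)` and its difference set meets the lattice only in `0`, so
Blichfeldt's principle (Mathlib's `MeasureTheory.exists_pair_mem_lattice_not_disjoint_vadd`)
bounds its volume by the covolume.

Main results:

* `measurePreserving_sub_shear`: a measurable shear `z ↦ z − g z` (with `g z` depending only on
  the coordinates `≥ j` and vanishing there) preserves Lebesgue measure [folklore];
* `exists_squeeze`: Tao–Vu's squeezing lemma (Lemma 3.31) in coordinates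
  [cite: TaoVu2006, Lemma 3.31];
* `minkowski_second_core`: the upper bound of Minkowski's second theorem for a seminorm, a
  countable subgroup with a fundamental domain, and levels `λ₀ ≤ ⋯ ≤ λ_{q−1}` such that every
  lattice vector of norm `< λ_k` lies in the span of the first `k` coordinate vectors
  [cite: TaoVu2006, Theorem 3.30];
* `prod_seminorm_mul_volume_le_of_directional`, `exists_directional_system`,
  `exists_directional_system_prod_mul_volume_le`: the bound `N(v₀)⋯N(v_{q−1}) vol{N < 1} ≤ 2^q`
  for a directional system of `ℤ^q` w.r.t. a norm `N` (transport of the core statement by the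
  linear map `e_k ↦ v_k`, with the fundamental domain `T⁻¹[0,1)^q` of `T⁻¹ℤ^q` built by hand), and
  the greedy existence of such a system (`v_k` an integer vector of minimal norm outside the
  real span of `v₀, …, v_{k−1}`; finiteness of integer points in `N`-balls from
  `exists_pos_mul_norm_le_seminorm`) [cite: EvertseGyory2015, Thm 4.3.1 (p. 70)].

## References

* [EvertseGyory2015] J.-H. Evertse, K. Győry, *Unit Equations in Diophantine Number Theory*,
  Cambridge Stud. Adv. Math. 146, CUP 2015 — Thm 4.3.1 (p. 70).
* [TaoVu2006] T. Tao, V. Vu, *Additive Combinatorics*, Cambridge Stud. Adv. Math. 105, CUP 2006,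
  doi:10.1017/CBO9780511755149 — Theorem 3.30 and Lemma 3.31 (pp. 159–162).
-/

noncomputable section

open MeasureTheory Real Finset Module Set
open scoped Matrix Pointwise

namespace Literature.NumberTheory.DiophantineGeometry.Dioph

variable {q : ℕ}

/-! ### Shears preserve Lebesgue measure -/

/-- A measurable "shear" `z ↦ z − g z` of `ℝ^q`, where `g z` depends only on the coordinates
`i ≥ j` of `z` and has vanishing coordinates `i ≥ j`, preserves Lebesgue measure (Fubini: on
each fibre of the projection to the coordinates `≥ j` it is a translation). [folklore] -/
theorem measurePreserving_sub_shear (j : ℕ) (g : (Fin q → ℝ) → (Fin q → ℝ)) (hg : Measurable g)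
    (hdep : ∀ z z', (∀ i : Fin q, j ≤ i.val → z i = z' i) → g z = g z')
    (hvan : ∀ z (i : Fin q), j ≤ i.val → g z i = 0) :
    MeasurePreserving (fun z => z - g z) volume volume := by
  classical
  let p : Fin q → Prop := fun i => j ≤ i.val
  let e := MeasurableEquiv.piEquivPiSubtypeProd (fun _ : Fin q => ℝ) p
  have he : MeasurePreserving e volume volume :=
    volume_preserving_piEquivPiSubtypeProd (fun _ : Fin q => ℝ) p
  -- extension by zero from the coordinates `≥ j`
  let ext : ({i // p i} → ℝ) → (Fin q → ℝ) := fun b i => if h : p i then b ⟨i, h⟩ else 0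
  have hext : Measurable ext := by
    refine measurable_pi_lambda _ fun i => ?_
    by_cases h : p i
    · simp only [ext, h, dif_pos]
      exact measurable_pi_apply _
    · simp only [ext, h, dif_neg, not_false_eq_true]
      exact measurable_const
  let g₂ : ({i // p i} → ℝ) → ({i // ¬p i} → ℝ) := fun b i => g (ext b) i
  have hg₂ : Measurable g₂ :=
    measurable_pi_lambda _ fun i => (measurable_pi_apply _).comp (hg.comp hext)
  let Ψ : ({i // p i} → ℝ) × ({i // ¬p i} → ℝ) → ({i // p i} → ℝ) × ({i // ¬p i} → ℝ) :=
    fun ba => (ba.1, ba.2 - g₂ ba.1)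
  have hΨ : MeasurePreserving Ψ (volume.prod volume) (volume.prod volume) := by
    refine MeasurePreserving.skew_product (f := id) (g := fun b a => a - g₂ b)
      (MeasurePreserving.id _) ?_ ?_
    · exact measurable_snd.sub (hg₂.comp measurable_fst)
    · refine Filter.Eventually.of_forall fun b => ?_
      have := map_add_right_eq_self (volume : Measure ({i // ¬p i} → ℝ)) (-g₂ b)
      simpa [sub_eq_add_neg] using this
  have hcomm : ∀ z, e (z - g z) = Ψ (e z) := by
    intro z
    have hgz : g z = g (ext fun i : {i // p i} => z i) :=
      hdep _ _ (fun i hi => by simp [ext, p, hi])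
    refine Prod.ext ?_ ?_
    · funext i
      simp [e, Ψ, MeasurableEquiv.piEquivPiSubtypeProd, Equiv.piEquivPiSubtypeProd, hvan z i i.2]
    · funext i
      simp [e, Ψ, g₂, MeasurableEquiv.piEquivPiSubtypeProd, Equiv.piEquivPiSubtypeProd, ← hgz]
  have hfun : (fun z => z - g z) = e.symm ∘ Ψ ∘ e := by
    funext z
    simp only [Function.comp_apply, ← hcomm, MeasurableEquiv.symm_apply_apply]
  rw [hfun]
  exact he.symm.comp (hΨ.comp he)

/-- Images under the shear `z ↦ z + g z` (with `g` as in `measurePreserving_sub_shear`) of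
measurable sets are measurable and have the same volume. [folklore] -/
theorem volume_image_add_shear (j : ℕ) (g : (Fin q → ℝ) → (Fin q → ℝ)) (hg : Measurable g)
    (hdep : ∀ z z', (∀ i : Fin q, j ≤ i.val → z i = z' i) → g z = g z')
    (hvan : ∀ z (i : Fin q), j ≤ i.val → g z i = 0) (X : Set (Fin q → ℝ))
    (hX : MeasurableSet X) :
    MeasurableSet ((fun z => z + g z) '' X) ∧ volume ((fun z => z + g z) '' X) = volume X := by
  have hgsub : ∀ z, g (z - g z) = g z :=
    fun z => hdep _ _ (fun i hi => by simp [hvan z i hi])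
  have hgadd : ∀ z, g (z + g z) = g z :=
    fun z => hdep _ _ (fun i hi => by simp [hvan z i hi])
  have himage : (fun z => z + g z) '' X = (fun z => z - g z) ⁻¹' X := by
    ext y
    constructor
    · rintro ⟨z, hz, rfl⟩
      show z + g z - g (z + g z) ∈ X
      rwa [hgadd, add_sub_cancel_right]
    · intro hy
      exact ⟨y - g y, hy, by show y - g y + g (y - g y) = y; rw [hgsub, sub_add_cancel]⟩
  have hmp := measurePreserving_sub_shear j g hg hdep hvan
  rw [himage]
  exact ⟨hmp.measurable hX, hmp.measure_preimage hX.nullMeasurableSet⟩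

/-! ### The squeezing lemma (Tao–Vu, Lemma 3.31) -/

/-- **Squeezing lemma** (Tao–Vu, *Additive Combinatorics*, Lemma 3.31), in coordinates. Let
`K ⊆ ℝ^q` be open and convex, `A ⊆ K` measurable, `j ≤ q` and `0 < θ ≤ 1`. Then there is a
measurable `A' ⊆ K` with `vol(A') = θ^j vol(A)` such that any two points of `A'` with the same
coordinates `≥ j` differ by `θ` times the difference of two points of `A` with the same
coordinates `≥ j` (i.e. `(A' − A') ∩ ℝ^j ⊆ θ · ((A − A) ∩ ℝ^j)`). `A'` is obtained by contracting
each fibre of the projection `x ↦ (x_i)_{i ≥ j}` by the factor `θ` towards a (measurably chosen)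
point of the corresponding fibre of `K`. [cite: TaoVu2006, Lemma 3.31 (p. 161)] -/
theorem exists_squeeze (K : Set (Fin q → ℝ)) (hKo : IsOpen K) (hKc : Convex ℝ K)
    (A : Set (Fin q → ℝ)) (hAm : MeasurableSet A) (hAK : A ⊆ K) {j : ℕ} (hj : j ≤ q)
    {θ : ℝ} (hθ0 : 0 < θ) (hθ1 : θ ≤ 1) :
    ∃ A' : Set (Fin q → ℝ), MeasurableSet A' ∧ A' ⊆ K ∧
      volume A' = ENNReal.ofReal (θ ^ j) * volume A ∧
      ∀ x ∈ A', ∀ y ∈ A', (∀ i : Fin q, j ≤ i.val → x i = y i) →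
        ∃ x₀ ∈ A, ∃ y₀ ∈ A, (∀ i : Fin q, j ≤ i.val → x₀ i = y₀ i) ∧ x - y = θ • (x₀ - y₀) := by
  classical
  -- `merge x z`: first `j` coordinates from `x`, the others from `z`
  let merge : (Fin q → ℝ) → (Fin q → ℝ) → (Fin q → ℝ) :=
    fun x z i => if i.val < j then x i else z i
  have merge_cont : ∀ x, Continuous (merge x) := by
    intro x
    refine continuous_pi fun i => ?_
    by_cases h : i.val < j
    · simp only [merge, h, if_true]
      exact continuous_const
    · simp only [merge, h, if_false]
      exact continuous_apply i
  have merge_dep : ∀ x z z', (∀ i : Fin q, j ≤ i.val → z i = z' i) → merge x z = merge x z' := by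
    intro x z z' h
    funext i
    by_cases hi : i.val < j
    · simp [merge, hi]
    · simp only [merge, hi, if_false]
      exact h i (not_lt.mp hi)
  have merge_self : ∀ z, merge z z = z := by
    intro z; funext i; simp [merge]
  have merge_ge : ∀ x z (i : Fin q), j ≤ i.val → merge x z i = z i := by
    intro x z i hi
    simp [merge, not_lt.mpr hi]
  -- a dense sequence and the first index whose merge lands in `K`
  rcases isEmpty_or_nonempty (Fin q → ℝ) with hE | hE
  · exact (hE.false 0).elim
  obtain ⟨d, hd⟩ := TopologicalSpace.exists_dense_seq (Fin q → ℝ)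
  let good : ℕ → (Fin q → ℝ) → Prop := fun n z => merge (d n) z ∈ K
  have good_open : ∀ n, IsOpen {z | good n z} := fun n => hKo.preimage (merge_cont (d n))
  let idx : (Fin q → ℝ) → ℕ := fun z => if h : ∃ n, good n z then Nat.find h + 1 else 0
  let D' : ℕ → (Fin q → ℝ) := fun n => Nat.casesOn n 0 fun m => d m
  let sec : (Fin q → ℝ) → (Fin q → ℝ) := fun z => merge (D' (idx z)) z
  have sec_ge : ∀ z (i : Fin q), j ≤ i.val → sec z i = z i := fun z i hi => merge_ge _ _ i hi
  have good_dep : ∀ n z z', (∀ i : Fin q, j ≤ i.val → z i = z' i) → (good n z ↔ good n z') := by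
    intro n z z' h
    simp only [good]
    rw [merge_dep (d n) z z' h]
  have idx_dep : ∀ z z', (∀ i : Fin q, j ≤ i.val → z i = z' i) → idx z = idx z' := by
    intro z z' h
    have hiff : ∀ n, good n z ↔ good n z' := fun n => good_dep n z z' h
    simp only [idx]
    by_cases hz : ∃ n, good n z
    · have hz' : ∃ n, good n z' := by obtain ⟨n, hn⟩ := hz; exact ⟨n, (hiff n).mp hn⟩
      rw [dif_pos hz, dif_pos hz']
      congr 1
      rw [Nat.find_eq_iff]
      refine ⟨(hiff _).mpr (Nat.find_spec hz'), fun n hn h' => ?_⟩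
      exact Nat.find_min hz' hn ((hiff n).mp h')
    · have hz' : ¬∃ n, good n z' := by
        rintro ⟨n, hn⟩; exact hz ⟨n, (hiff n).mpr hn⟩
      rw [dif_neg hz, dif_neg hz']
  have sec_dep : ∀ z z', (∀ i : Fin q, j ≤ i.val → z i = z' i) → sec z = sec z' := by
    intro z z' h
    simp only [sec]
    rw [idx_dep z z' h, merge_dep _ z z' h]
  have sec_mem : ∀ z ∈ K, sec z ∈ K := by
    intro z hz
    have hex : ∃ n, good n z := by
      have hopen : IsOpen {x | merge x z ∈ K} := by
        refine hKo.preimage ?_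
        refine continuous_pi fun i => ?_
        by_cases h : i.val < j
        · simp only [merge, h, if_true]; exact continuous_apply i
        · simp only [merge, h, if_false]; exact continuous_const
      obtain ⟨n, hn⟩ := hd.exists_mem_open hopen ⟨z, by simp [merge_self, hz]⟩
      exact ⟨n, hn⟩
    simp only [sec, idx, dif_pos hex]
    exact Nat.find_spec hex
  have sec_meas : Measurable sec := by
    have hidx : Measurable idx := by
      refine measurable_to_countable' fun n => ?_
      rcases n with _ | m
      · have : idx ⁻¹' {0} = (⋃ k, {z | good k z})ᶜ := by
          ext z
          simp only [Set.mem_preimage, Set.mem_singleton_iff, Set.mem_compl_iff, Set.mem_iUnion,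
            Set.mem_setOf_eq, idx]
          by_cases h : ∃ n, good n z
          · rw [dif_pos h]; simp only [Nat.succ_ne_zero, false_iff, not_not]; exact h
          · rw [dif_neg h]; simp only [true_iff]; exact fun ⟨k, hk⟩ => h ⟨k, hk⟩
        rw [this]
        exact (MeasurableSet.iUnion fun k => (good_open k).measurableSet).compl
      · have : idx ⁻¹' {m + 1} = {z | good m z} ∩ ⋂ k ∈ Finset.range m, {z | good k z}ᶜ := by
          ext z
          simp only [Set.mem_preimage, Set.mem_singleton_iff, Set.mem_inter_iff, Set.mem_setOf_eq,
            Set.mem_iInter, Set.mem_compl_iff, Finset.mem_range, idx]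
          by_cases h : ∃ n, good n z
          · rw [dif_pos h, Nat.succ_inj, Nat.find_eq_iff]
          · rw [dif_neg h]
            simp only [Nat.zero_ne_add_one, false_iff, not_and]
            exact fun hm _ => h ⟨m, hm⟩
        rw [this]
        refine (good_open m).measurableSet.inter ?_
        exact MeasurableSet.biInter (Set.to_countable _) fun k _ => (good_open k).measurableSet.compl
    have hF : Measurable fun p : (Fin q → ℝ) × ℕ => merge (D' p.2) p.1 :=
      measurable_from_prod_countable_left fun n => (merge_cont (D' n)).measurable
    exact hF.comp (measurable_id.prodMk hidx)
  -- the shear part `g` and the linear contraction `L`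
  let g : (Fin q → ℝ) → (Fin q → ℝ) := fun z i => if i.val < j then (1 - θ) * sec z i else 0
  have g_meas : Measurable g := by
    refine measurable_pi_lambda _ fun i => ?_
    by_cases h : i.val < j
    · simp only [g, h, if_true]
      exact ((measurable_pi_apply i).comp sec_meas).const_mul _
    · simp only [g, h, if_false]
      exact measurable_const
  have g_dep : ∀ z z', (∀ i : Fin q, j ≤ i.val → z i = z' i) → g z = g z' := by
    intro z z' h
    funext i
    simp only [g, sec_dep z z' h]
  have g_van : ∀ z (i : Fin q), j ≤ i.val → g z i = 0 := by
    intro z i hi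
    simp [g, not_lt.mpr hi]
  let dvec : Fin q → ℝ := fun i => if i.val < j then θ else 1
  let L : (Fin q → ℝ) →ₗ[ℝ] (Fin q → ℝ) := Matrix.toLin' (Matrix.diagonal dvec)
  have L_apply : ∀ x i, L x i = dvec i * x i := by
    intro x i
    simp [L, Matrix.toLin'_apply, Matrix.mulVec_diagonal]
  have L_ge : ∀ x (i : Fin q), j ≤ i.val → L x i = x i := by
    intro x i hi
    rw [L_apply]
    simp [dvec, not_lt.mpr hi]
  have L_det : LinearMap.det L = θ ^ j := by
    rw [show L = Matrix.toLin' (Matrix.diagonal dvec) from rfl, LinearMap.det_toLin',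
      Matrix.det_diagonal]
    simp only [dvec]
    rw [Finset.prod_ite, Finset.prod_const_one, mul_one, Finset.prod_const]
    congr 1
    -- `#{i : Fin q | i < j} = j`
    have : (Finset.univ.filter fun i : Fin q => i.val < j) = (Finset.range j).attachFin
        (fun i hi => lt_of_lt_of_le (Finset.mem_range.mp hi) hj) := by
      ext i
      simp [Finset.mem_attachFin]
    rw [this, Finset.card_attachFin, Finset.card_range]
  have L_inj : Function.Injective L := by
    intro x y hxy
    funext i
    have := congrFun hxy i
    rw [L_apply, L_apply] at this
    have hd : dvec i ≠ 0 := by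
      by_cases h : i.val < j <;> simp [dvec, h, hθ0.ne']
    exact mul_left_cancel₀ hd this
  -- the squeezed set
  let Φ : (Fin q → ℝ) → (Fin q → ℝ) := fun w => L w + g (L w)
  have Φ_eq : ∀ w, Φ w = θ • w + (1 - θ) • sec w := by
    intro w
    have hg' : g (L w) = g w := g_dep _ _ (fun i hi => L_ge w i hi)
    show L w + g (L w) = θ • w + (1 - θ) • sec w
    rw [hg']
    funext i
    simp only [Pi.add_apply, Pi.smul_apply, smul_eq_mul, L_apply, g, dvec]
    by_cases h : i.val < j
    · simp [h]
    · simp only [h, if_false, one_mul, add_zero]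
      rw [sec_ge w i (not_lt.mp h)]
      ring
  have Φ_ge : ∀ w (i : Fin q), j ≤ i.val → Φ w i = w i := by
    intro w i hi
    rw [Φ_eq]
    simp only [Pi.add_apply, Pi.smul_apply, smul_eq_mul, sec_ge w i hi]
    ring
  refine ⟨Φ '' A, ?_, ?_, ?_, ?_⟩
  · -- measurability
    have h1 : MeasurableSet (L '' A) :=
      hAm.image_of_continuousOn_injOn (LinearMap.continuous_of_finiteDimensional L).continuousOn
        L_inj.injOn
    have h2 := (volume_image_add_shear j g g_meas g_dep g_van (L '' A) h1).1
    rwa [Set.image_image] at h2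
  · -- `Φ '' A ⊆ K`
    rintro _ ⟨w, hw, rfl⟩
    rw [Φ_eq]
    exact hKc (hAK hw) (sec_mem w (hAK hw)) hθ0.le (by linarith) (by ring)
  · -- volume
    have h1 : MeasurableSet (L '' A) :=
      hAm.image_of_continuousOn_injOn (LinearMap.continuous_of_finiteDimensional L).continuousOn
        L_inj.injOn
    have h2 := (volume_image_add_shear j g g_meas g_dep g_van (L '' A) h1).2
    rw [Set.image_image] at h2
    rw [h2, MeasureTheory.Measure.addHaar_image_linearMap, L_det, abs_of_pos (pow_pos hθ0 j)]
  · -- differences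
    rintro _ ⟨w, hw, rfl⟩ _ ⟨w', hw', rfl⟩ hagree
    have hww' : ∀ i : Fin q, j ≤ i.val → w i = w' i := by
      intro i hi
      rw [← Φ_ge w i hi, ← Φ_ge w' i hi]
      exact hagree i hi
    refine ⟨w, hw, w', hw', hww', ?_⟩
    rw [Φ_eq, Φ_eq, sec_dep w w' hww', smul_sub]
    abel

/-! ### Minkowski's second theorem: the core statement -/

/-- **Minkowski's second theorem (upper bound), core form** (Tao–Vu, Thm 3.30, proof of the
upper bound in (3.15)). Let `N` be a continuous seminorm on `ℝ^q` (`q ≥ 1`), `L` a countable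
subgroup of `ℝ^q` with a measurable fundamental domain `F`, and `0 < λ₀ ≤ λ₁ ≤ ⋯ ≤ λ_{q−1}` reals
such that for each `k`, every `γ ∈ L` with `N γ < λ_k` lies in the span of the first `k`
coordinate vectors (`γ_i = 0` for `i ≥ k`). Then `λ₀ ⋯ λ_{q−1} · vol {N < 1} ≤ 2^q · vol F`.
(For the successive minima of a symmetric convex body w.r.t. a lattice this is the situation
after a linear change of variables taking a directional basis to the standard basis.)
[cite: TaoVu2006, Theorem 3.30 (pp. 159–162)] -/
theorem minkowski_second_core (hq : 0 < q) (N : Seminorm ℝ (Fin q → ℝ)) (hNc : Continuous N)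
    (L : AddSubgroup (Fin q → ℝ)) [Countable L] (F : Set (Fin q → ℝ))
    (hF : IsAddFundamentalDomain L F volume)
    (lam : Fin q → ℝ) (hpos : ∀ k, 0 < lam k) (hmono : Monotone lam)
    (hempty : ∀ (k : Fin q), ∀ γ ∈ L, N γ < lam k → ∀ i : Fin q, k ≤ i → γ i = 0) :
    ENNReal.ofReal (∏ k, lam k) * volume {x : Fin q → ℝ | N x < 1} ≤ 2 ^ q * volume F := by
  classical
  -- levels extended to `ℕ`
  let lmax : ℝ := lam ⟨q - 1, by omega⟩
  let lamN : ℕ → ℝ := fun n => if h : n < q then lam ⟨n, h⟩ else lmax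
  have lamN_eq : ∀ (n : ℕ) (h : n < q), lamN n = lam ⟨n, h⟩ := fun n h => dif_pos h
  have lamN_pos : ∀ n, 0 < lamN n := by
    intro n; by_cases h : n < q
    · rw [lamN_eq n h]; exact hpos _
    · simp only [lamN, h, dif_neg, not_false_eq_true]; exact hpos _
  have lamN_mono : ∀ {a b : ℕ}, a ≤ b → lamN a ≤ lamN b := by
    intro a b hab
    by_cases hb : b < q
    · rw [lamN_eq a (lt_of_le_of_lt hab hb), lamN_eq b hb]
      exact hmono (Fin.mk_le_mk.mpr hab)
    · have hbmax : lamN b = lmax := by simp [lamN, hb]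
      rw [hbmax]
      by_cases ha : a < q
      · rw [lamN_eq a ha]; exact hmono (Fin.mk_le_mk.mpr (by omega))
      · simp [lamN, ha]
  have lamN_max : lamN (q - 1) = lmax := by rw [lamN_eq (q - 1) (by omega)]
  have lamN_le_max : ∀ n, lamN n ≤ lmax := by
    intro n; by_cases h : n < q
    · rw [← lamN_max]; exact lamN_mono (by omega)
    · simp [lamN, h]
  have lmax_pos : 0 < lmax := hpos _
  -- the mother set `A₀ = (λ_max / 2) B`
  set B : Set (Fin q → ℝ) := {x | N x < 1} with hB
  set A₀ : Set (Fin q → ℝ) := {x | N x < lmax / 2} with hA₀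
  have hA₀o : IsOpen A₀ := isOpen_lt hNc continuous_const
  have hA₀c : Convex ℝ A₀ := by
    have : A₀ = N.ball 0 (lmax / 2) := by
      ext x; simp [Seminorm.mem_ball, hA₀]
    rw [this]; exact N.convex_ball _ _
  have hA₀m : MeasurableSet A₀ := hA₀o.measurableSet
  have hA₀vol : volume A₀ = ENNReal.ofReal ((lmax / 2) ^ q) * volume B := by
    have hset : A₀ = (lmax / 2) • B := by
      ext x
      rw [Set.mem_smul_set_iff_inv_smul_mem₀ (by positivity)]
      simp only [hA₀, hB, Set.mem_setOf_eq, map_smul_eq_mul, Real.norm_eq_abs,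
        abs_inv, abs_of_pos (half_pos lmax_pos)]
      rw [inv_mul_lt_iff₀ (half_pos lmax_pos), mul_one]
    rw [hset, MeasureTheory.Measure.addHaar_smul_of_nonneg volume (by positivity),
      Module.finrank_fin_fun]
  have hA₀diff : ∀ x ∈ A₀, ∀ y ∈ A₀, N (x - y) < lmax := by
    intro x hx y hy
    simp only [hA₀, Set.mem_setOf_eq] at hx hy
    calc N (x - y) ≤ N x + N y := map_sub_le_add N x y
      _ < lmax / 2 + lmax / 2 := add_lt_add hx hy
      _ = lmax := by ring
  -- the invariant of the iteration
  let Inv : ℕ → Set (Fin q → ℝ) → Prop := fun j A =>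
    ∀ i : ℕ, ∀ x ∈ A, ∀ y ∈ A, (∀ i' : Fin q, i ≤ i'.val → x i' = y i') →
      N (x - y) < lamN (min (i - 1) j) * lmax / lamN j
  have step : ∀ j : ℕ, j ≤ q - 1 → ∃ A : Set (Fin q → ℝ), MeasurableSet A ∧ A ⊆ A₀ ∧
      volume A * ENNReal.ofReal (lamN j ^ j) =
        ENNReal.ofReal (∏ i ∈ Finset.range j, lamN i) * volume A₀ ∧ Inv j A := by
    intro j
    induction j with
    | zero =>
      intro _
      refine ⟨A₀, hA₀m, subset_rfl, by simp, ?_⟩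
      intro i x hx y hy _
      have : lamN (min (i - 1) 0) * lmax / lamN 0 = lmax := by
        rw [Nat.min_zero]; field_simp [(lamN_pos 0).ne']
      rw [this]
      exact hA₀diff x hx y hy
    | succ j ih =>
      intro hj
      obtain ⟨A, hAm, hAsub, hAvol, hAinv⟩ := ih (by omega)
      set θ : ℝ := lamN j / lamN (j + 1) with hθ
      have hθ0 : 0 < θ := div_pos (lamN_pos _) (lamN_pos _)
      have hθ1 : θ ≤ 1 := (div_le_one (lamN_pos _)).mpr (lamN_mono (Nat.le_succ j))
      obtain ⟨A', hA'm, hA'sub, hA'vol, hA'diff⟩ :=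
        exists_squeeze A₀ hA₀o hA₀c A hAm hAsub (j := j + 1) (by omega) hθ0 hθ1
      refine ⟨A', hA'm, hA'sub, ?_, ?_⟩
      · -- volume bookkeeping
        rw [hA'vol, mul_assoc, mul_comm (volume A), ← mul_assoc, ← ENNReal.ofReal_mul
          (pow_nonneg hθ0.le _), ← mul_pow, hθ, div_mul_cancel₀ _ (lamN_pos _).ne',
          pow_succ, ENNReal.ofReal_mul (pow_nonneg (lamN_pos j).le _), mul_comm
          (ENNReal.ofReal (lamN j ^ j)), mul_assoc, mul_comm _ (volume A), hAvol, ← mul_assoc,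
          ← ENNReal.ofReal_mul (lamN_pos j).le, Finset.prod_range_succ, mul_comm (lamN j)]
      · -- the invariant
        intro i x hx y hy hxy
        by_cases hij : i ≤ j + 1
        · have hxy' : ∀ i' : Fin q, j + 1 ≤ i'.val → x i' = y i' :=
            fun i' hi' => hxy i' (le_trans hij hi')
          obtain ⟨x₀, hx₀, y₀, hy₀, -, hdiff⟩ := hA'diff x hx y hy hxy'
          have hx₀y₀ : ∀ i' : Fin q, i ≤ i'.val → x₀ i' = y₀ i' := by
            intro i' hi'
            have h1 : (x - y) i' = 0 := by simp [hxy i' hi']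
            rw [hdiff] at h1
            simp only [Pi.smul_apply, Pi.sub_apply, smul_eq_mul, mul_eq_zero, hθ0.ne',
              false_or] at h1
            linarith
          have hN₀ := hAinv i x₀ hx₀ y₀ hy₀ hx₀y₀
          rw [hdiff, map_smul_eq_mul, Real.norm_eq_abs, abs_of_pos hθ0]
          have hmin1 : min (i - 1) j = i - 1 := Nat.min_eq_left (by omega)
          have hmin2 : min (i - 1) (j + 1) = i - 1 := Nat.min_eq_left (by omega)
          rw [hmin1] at hN₀
          rw [hmin2, hθ]
          have hj0 := lamN_pos j
          have hj1 := lamN_pos (j + 1)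
          calc lamN j / lamN (j + 1) * N (x₀ - y₀)
              < lamN j / lamN (j + 1) * (lamN (i - 1) * lmax / lamN j) :=
                mul_lt_mul_of_pos_left hN₀ (div_pos hj0 hj1)
            _ = lamN (i - 1) * lmax / lamN (j + 1) := by field_simp
        · push Not at hij
          have hmin : min (i - 1) (j + 1) = j + 1 := Nat.min_eq_right (by omega)
          have hcancel : lamN (j + 1) * lmax / lamN (j + 1) = lmax := by
            field_simp [(lamN_pos (j + 1)).ne']
          rw [hmin, hcancel]
          exact hA₀diff x (hA'sub hx) y (hA'sub hy)
  -- the final set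
  obtain ⟨A, hAm, hAsub, hAvol, hAinv⟩ := step (q - 1) le_rfl
  -- its difference set meets `L` only in `0`
  have hAdiff : ∀ x ∈ A, ∀ y ∈ A, x - y ∈ L → x = y := by
    intro x hx y hy hL
    by_contra hne
    set γ := x - y with hγ
    have hγ0 : γ ≠ 0 := sub_ne_zero.mpr hne
    -- the least `i` with `γ ∈ ℝ^i`
    have hex : ∃ i : ℕ, ∀ i' : Fin q, i ≤ i'.val → γ i' = 0 := ⟨q, fun i' hi' => by omega⟩
    set i₀ := Nat.find hex with hi₀
    have hi₀spec : ∀ i' : Fin q, i₀ ≤ i'.val → γ i' = 0 := Nat.find_spec hex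
    have hi₀pos : 0 < i₀ := by
      rw [Nat.pos_iff_ne_zero]
      intro h0
      apply hγ0
      funext i'
      exact hi₀spec i' (by omega)
    have hi₀le : i₀ ≤ q := Nat.find_min' hex (fun i' hi' => by omega)
    have hN : N γ < lamN (i₀ - 1) := by
      have := hAinv i₀ x hx y hy (fun i' hi' => sub_eq_zero.mp (hi₀spec i' hi'))
      rwa [Nat.min_eq_left (by omega), lamN_max, mul_div_assoc, div_self lmax_pos.ne',
        mul_one] at this
    have hlt : i₀ - 1 < q := by omega
    rw [lamN_eq _ hlt] at hN
    have hzero := hempty ⟨i₀ - 1, hlt⟩ γ hL hN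
    have : i₀ - 1 < i₀ := by omega
    exact Nat.find_min hex this (fun i' hi' => hzero i' (Fin.mk_le_mk.mpr hi' |>.trans_eq rfl))
  -- Blichfeldt
  have hvolA : volume A ≤ volume F := by
    by_contra hlt
    push Not at hlt
    obtain ⟨a, b, hab, hdisj⟩ :=
      MeasureTheory.exists_pair_mem_lattice_not_disjoint_vadd hF hAm.nullMeasurableSet hlt
    obtain ⟨z, hza, hzb⟩ := Set.not_disjoint_iff.mp hdisj
    obtain ⟨x, hx, rfl⟩ : ∃ x ∈ A, (a : Fin q → ℝ) + x = z := by
      simpa [AddSubgroup.vadd_def, Set.mem_vadd_set] using hza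
    obtain ⟨y, hy, hyeq⟩ : ∃ y ∈ A, (b : Fin q → ℝ) + y = (a : Fin q → ℝ) + x := by
      simpa [AddSubgroup.vadd_def, Set.mem_vadd_set] using hzb
    have hmem : x - y ∈ L := by
      have : x - y = (b : Fin q → ℝ) - a := by
        linear_combination -hyeq
      rw [this]
      exact L.sub_mem b.2 a.2
    have hxy := hAdiff x hx y hy hmem
    apply hab
    have : (a : Fin q → ℝ) = b := by
      have := hyeq; rw [hxy] at this; exact (add_right_cancel this).symm
    exact Subtype.ext this
  -- conclusion
  rw [lamN_max] at hAvol
  have hkey : volume A * ENNReal.ofReal (lmax ^ (q - 1)) =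
      ENNReal.ofReal ((∏ k, lam k) / 2 ^ q) * ENNReal.ofReal (lmax ^ (q - 1)) * volume B := by
    rw [hAvol, hA₀vol, ← mul_assoc, ← ENNReal.ofReal_mul (Finset.prod_nonneg
      fun i _ => (lamN_pos i).le), ← ENNReal.ofReal_mul (div_nonneg
      (Finset.prod_nonneg fun k _ => (hpos k).le) (by positivity))]
    congr 2
    have hprod : (∏ k, lam k) = (∏ i ∈ Finset.range (q - 1), lamN i) * lmax := by
      have h1 : (∏ k : Fin q, lam k) = ∏ i ∈ Finset.range q, lamN i := by
        rw [Finset.prod_range]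
        exact Finset.prod_congr rfl fun k _ => (lamN_eq k.val k.2).symm
      rw [h1, ← lamN_max]
      conv_lhs => rw [show q = (q - 1) + 1 by omega]
      rw [Finset.prod_range_succ]
    rw [hprod, div_pow]
    have h2 : (2 : ℝ) ^ q = 2 ^ (q - 1) * 2 := by
      conv_lhs => rw [show q = (q - 1) + 1 by omega]
      rw [pow_succ]
    rw [h2, show lmax ^ q = lmax ^ (q - 1) * lmax by
      conv_lhs => rw [show q = (q - 1) + 1 by omega]
      rw [pow_succ]]
    field_simp
  have hfin : ENNReal.ofReal (lmax ^ (q - 1)) ≠ 0 := by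
    rw [Ne, ENNReal.ofReal_eq_zero, not_le]; positivity
  have hvolA' : volume A = ENNReal.ofReal ((∏ k, lam k) / 2 ^ q) * volume B := by
    have := hkey
    rw [mul_comm (ENNReal.ofReal ((∏ k, lam k) / 2 ^ q)) (ENNReal.ofReal (lmax ^ (q - 1))),
      mul_assoc, mul_comm] at this
    exact (ENNReal.mul_right_inj hfin ENNReal.ofReal_ne_top).mp this
  have h2q : ENNReal.ofReal ((∏ k, lam k) / 2 ^ q) = ENNReal.ofReal (∏ k, lam k) / 2 ^ q := by
    rw [ENNReal.ofReal_div_of_pos (by positivity), ENNReal.ofReal_pow (by norm_num),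
      ENNReal.ofReal_ofNat]
  rw [hvolA', h2q] at hvolA
  calc ENNReal.ofReal (∏ k, lam k) * volume B
      = 2 ^ q * (ENNReal.ofReal (∏ k, lam k) / 2 ^ q * volume B) := by
        rw [← mul_assoc, ENNReal.mul_div_cancel (by positivity) (by simp)]
    _ ≤ 2 ^ q * volume F := by gcongr

/-! ### Minkowski's second theorem for `ℤ^q` and a directional system -/

/-- Vectors in the real span of the coordinate vectors `e_l`, `l ∈ S`, have vanishing coordinates
outside `S`. [folklore] -/
theorem apply_eq_zero_of_mem_span_single {S : Set (Fin q)} {y : Fin q → ℝ}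
    (hy : y ∈ Submodule.span ℝ ((fun l : Fin q => (Pi.single l (1 : ℝ) : Fin q → ℝ)) '' S))
    (i : Fin q) (hi : i ∉ S) : y i = 0 := by
  induction hy using Submodule.span_induction with
  | mem x hx =>
    obtain ⟨l, hl, rfl⟩ := hx
    have : l ≠ i := fun h => hi (h ▸ hl)
    simp [Ne.symm this]
  | zero => rfl
  | add x y _ _ hx hy => simp [hx, hy]
  | smul c x _ hx => simp [hx]

/-- **Minkowski's second theorem, upper bound, for `ℤ^q`** (Evertse–Győry, Thm 4.3.1; Minkowski
1896), relative to a *directional system*: let `N` be a norm on `ℝ^q` (`q ≥ 1`) and let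
`V₀, …, V_{q−1} ∈ ℝ^q` be linearly independent with `N(V₀) ≤ ⋯ ≤ N(V_{q−1})` and such that every
integer vector of norm `< N(V_k)` lies in the real span of `V₀, …, V_{k−1}`. Then
`N(V₀) ⋯ N(V_{q−1}) · vol {N < 1} ≤ 2^q`. (With `λ_{k+1} = N(V_k)` the successive minima of the
unit ball of `N` w.r.t. `ℤ^q`, this is `λ₁ ⋯ λ_q vol(B_N) ≤ 2^q d(ℤ^q)`.) Proof: apply
`minkowski_second_core` to `N ∘ T` and `T⁻¹(ℤ^q)`, `T` the linear map `e_k ↦ V_k`.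
[cite: EvertseGyory2015, Thm 4.3.1 (p. 70)] -/
theorem prod_seminorm_mul_volume_le_of_directional (hq : 0 < q) (N : Seminorm ℝ (Fin q → ℝ))
    (hN : ∀ x, N x = 0 → x = 0) (V : Fin q → Fin q → ℝ)
    (hli : LinearIndependent ℝ V) (hmono : Monotone fun k => N (V k))
    (hdir : ∀ k : Fin q, ∀ z : Fin q → ℤ, N (fun i => (z i : ℝ)) < N (V k) →
      (fun i => (z i : ℝ)) ∈ Submodule.span ℝ (V '' {l | l < k})) :
    ENNReal.ofReal (∏ k, N (V k)) * volume {x : Fin q → ℝ | N x < 1} ≤ 2 ^ q := by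
  classical
  -- the linear map `T : e_k ↦ V_k`
  set M : Matrix (Fin q) (Fin q) ℝ := Matrix.of fun i k => V k i with hM
  set T : (Fin q → ℝ) →ₗ[ℝ] (Fin q → ℝ) := Matrix.toLin' M with hT
  have T_single : ∀ k, T (Pi.single k 1) = V k := by
    intro k
    rw [hT, Matrix.toLin'_apply, Matrix.mulVec_single_one]
    ext i; simp [hM, Matrix.col]
  have hcol : M.col = V := by ext k i; simp [hM, Matrix.col]
  have hMunit : IsUnit M := Matrix.linearIndependent_cols_iff_isUnit.mp (hcol ▸ hli)
  have hdetT : LinearMap.det T ≠ 0 := by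
    rw [hT, LinearMap.det_toLin']
    exact ((Matrix.isUnit_iff_isUnit_det _).mp hMunit).ne_zero
  have T_inj : Function.Injective T := by
    rw [hT]
    exact Matrix.mulVec_injective_iff_isUnit.mpr hMunit
  -- the seminorm `N ∘ T`
  let N' : Seminorm ℝ (Fin q → ℝ) := N.comp T
  have N'_apply : ∀ x, N' x = N (T x) := fun x => rfl
  have hN'c : Continuous N' := seminorm_continuous N'
  -- the lattice `T⁻¹(ℤ^q)` and its fundamental domain `T⁻¹([0,1)^q)`
  let L : AddSubgroup (Fin q → ℝ) :=
    { carrier := {c | ∃ z : Fin q → ℤ, (fun i => (z i : ℝ)) = T c}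
      zero_mem' := ⟨0, by rw [map_zero]; ext i; simp⟩
      add_mem' := by
        rintro a b ⟨za, ha⟩ ⟨zb, hb⟩
        refine ⟨za + zb, ?_⟩
        rw [map_add, ← ha, ← hb]
        ext i; simp
      neg_mem' := by
        rintro a ⟨za, ha⟩
        refine ⟨-za, ?_⟩
        rw [map_neg, ← ha]
        ext i; simp }
  have memL : ∀ c, c ∈ L ↔ ∃ z : Fin q → ℤ, (fun i => (z i : ℝ)) = T c := fun c => Iff.rfl
  haveI : Countable L := by
    have hf : ∀ c : L, ∃ z : Fin q → ℤ, (fun i => (z i : ℝ)) = T c := fun c => (memL c).mp c.2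
    choose f hf using hf
    refine Function.Injective.countable (f := f) fun a b hab => ?_
    apply Subtype.ext
    apply T_inj
    rw [← hf a, ← hf b, hab]
  let cube : Set (Fin q → ℝ) := Set.pi Set.univ fun _ => Set.Ico (0 : ℝ) 1
  let F : Set (Fin q → ℝ) := T ⁻¹' cube
  have hTc : Continuous T := LinearMap.continuous_of_finiteDimensional T
  have hcube_m : MeasurableSet cube := MeasurableSet.univ_pi fun _ => measurableSet_Ico
  have hF_m : MeasurableSet F := hcube_m.preimage hTc.measurable
  have hF : IsAddFundamentalDomain L F volume := by
    refine IsAddFundamentalDomain.mk' hF_m.nullMeasurableSet fun x => ?_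
    -- the unique `g` with `T (g + x) ∈ [0,1)^q` is `T⁻¹(-⌊T x⌋)`
    have hsurj : Function.Surjective T :=
      LinearMap.surjective_of_injective T_inj
    obtain ⟨g₀, hg₀⟩ := hsurj (fun i => -((⌊T x i⌋ : ℤ) : ℝ))
    have hg₀L : g₀ ∈ L := ⟨fun i => -⌊T x i⌋, by rw [hg₀]; ext i; simp⟩
    refine ⟨⟨g₀, hg₀L⟩, ?_, ?_⟩
    · show T (g₀ + x) ∈ cube
      simp only [cube, Set.mem_pi, Set.mem_univ, Set.mem_Ico, forall_true_left, map_add, hg₀,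
        Pi.add_apply]
      intro i
      constructor
      · linarith [Int.floor_le (T x i)]
      · linarith [Int.lt_floor_add_one (T x i)]
    · rintro ⟨g, hgL⟩ hg
      apply Subtype.ext
      show g = g₀
      obtain ⟨z, hz⟩ := (memL g).mp hgL
      have hgx : T (g + x) ∈ cube := hg
      simp only [cube, Set.mem_pi, Set.mem_univ, Set.mem_Ico, forall_true_left, map_add,
        Pi.add_apply] at hgx
      apply T_inj
      rw [hg₀, ← hz]
      ext i
      have h1 := hgx i
      have hzi : (z i : ℝ) = T g i := congrFun hz i
      rw [← hzi] at h1
      -- `z i + T x i ∈ [0,1)` forces `z i = -⌊T x i⌋`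
      have : z i = -⌊T x i⌋ := by
        have h2 := Int.floor_le (T x i)
        have h3 := Int.lt_floor_add_one (T x i)
        have : (z i : ℤ) + ⌊T x i⌋ = 0 := by
          have h5 : ((z i + ⌊T x i⌋ : ℤ) : ℝ) < 1 := by push_cast; linarith
          have h6 : (-1 : ℝ) < ((z i + ⌊T x i⌋ : ℤ) : ℝ) := by push_cast; linarith
          have h7 : (z i + ⌊T x i⌋ : ℤ) < 1 := by exact_mod_cast h5
          have h8 : (-1 : ℤ) < z i + ⌊T x i⌋ := by exact_mod_cast h6
          omega
        omega
      rw [this, Int.cast_neg]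
  -- volumes of the transported objects
  have hvolF : volume F = ENNReal.ofReal |(LinearMap.det T)⁻¹| := by
    show volume (T ⁻¹' cube) = _
    rw [MeasureTheory.Measure.addHaar_preimage_linearMap volume hdetT, volume_pi_pi]
    simp [Real.volume_Ico]
  have hvolB : volume {x : Fin q → ℝ | N' x < 1} =
      ENNReal.ofReal |(LinearMap.det T)⁻¹| * volume {x : Fin q → ℝ | N x < 1} := by
    have : {x : Fin q → ℝ | N' x < 1} = T ⁻¹' {x | N x < 1} := by
      ext x; simp [N'_apply]
    rw [this, MeasureTheory.Measure.addHaar_preimage_linearMap volume hdetT]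
  -- levels
  let lam : Fin q → ℝ := fun k => N (V k)
  have hVne : ∀ k, V k ≠ 0 := fun k => hli.ne_zero k
  have hpos : ∀ k, 0 < lam k := fun k =>
    (apply_nonneg N (V k)).lt_of_ne (fun h => hVne k (hN _ h.symm))
  -- the emptiness property for the transported lattice
  have hempty : ∀ (k : Fin q), ∀ γ ∈ L, N' γ < lam k → ∀ i : Fin q, k ≤ i → γ i = 0 := by
    intro k γ hγ hlt i hi
    obtain ⟨z, hz⟩ := (memL γ).mp hγ
    rw [N'_apply, ← hz] at hlt
    have hmem := hdir k z hlt
    rw [hz] at hmem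
    -- `span (V '' S) = (span (e '' S)).map T`
    have hVimg : V '' {l | l < k} = T '' ((fun l : Fin q => (Pi.single l (1 : ℝ) : Fin q → ℝ)) ''
        {l | l < k}) := by
      rw [Set.image_image]
      exact Set.image_congr fun l _ => (T_single l).symm
    rw [hVimg, Submodule.span_image] at hmem
    obtain ⟨y, hy, hyγ⟩ := Submodule.mem_map.mp hmem
    have hyeq : y = γ := T_inj hyγ
    subst hyeq
    exact apply_eq_zero_of_mem_span_single hy i (fun h => absurd hi (not_le.mpr h))
  -- apply the core theorem
  have hcore := minkowski_second_core hq N' hN'c L F hF lam hpos hmono hempty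
  rw [hvolB, hvolF, ← mul_assoc, mul_comm (ENNReal.ofReal (∏ k, lam k)), mul_assoc,
    mul_comm ((2 : ENNReal) ^ q)] at hcore
  have hd0 : ENNReal.ofReal |(LinearMap.det T)⁻¹| ≠ 0 := by
    rw [Ne, ENNReal.ofReal_eq_zero, not_le, abs_pos]
    exact inv_ne_zero hdetT
  exact (ENNReal.mul_le_mul_iff_right hd0 ENNReal.ofReal_ne_top).mp hcore

/-! ### Existence of a directional system in `ℤ^q` -/

/-- Finitely many integer vectors lie in a sublevel set `{N ≤ R}` of a norm on `ℝ^q`.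
[folklore] -/
theorem finite_int_seminorm_le (N : Seminorm ℝ (Fin q → ℝ)) (hN : ∀ x, N x = 0 → x = 0)
    (R : ℝ) : {z : Fin q → ℤ | N (fun i => (z i : ℝ)) ≤ R}.Finite := by
  obtain ⟨c, hc, hcN⟩ := exists_pos_mul_norm_le_seminorm N hN
  refine (Set.Finite.pi' (t := fun _ : Fin q => Set.Icc (-⌈R / c⌉ - 1) (⌈R / c⌉ + 1))
    fun _ => Set.finite_Icc _ _).subset ?_
  intro z hz
  simp only [Set.mem_setOf_eq] at hz ⊢
  intro i
  have h1 : c * ‖(fun i => (z i : ℝ))‖ ≤ R := (hcN _).trans hz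
  have h2 : ‖(fun i => (z i : ℝ))‖ ≤ R / c := by
    rw [le_div_iff₀ hc]; linarith
  have h3 : |(z i : ℝ)| ≤ R / c := by
    have := norm_le_pi_norm (fun i => (z i : ℝ)) i
    rw [Real.norm_eq_abs] at this
    exact this.trans h2
  have h4 := Int.le_ceil (R / c)
  rw [abs_le] at h3
  have h5 : ((-⌈R / c⌉ - 1 : ℤ) : ℝ) ≤ z i := by push_cast; linarith
  have h6 : ((z i : ℤ) : ℝ) ≤ ((⌈R / c⌉ + 1 : ℤ) : ℝ) := by push_cast; linarith
  exact ⟨by exact_mod_cast h5, by exact_mod_cast h6⟩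

/-- For a norm `N` on `ℝ^q` and a proper subspace `W`, some integer vector outside `W` has minimal
norm among all integer vectors outside `W`. [folklore] -/
theorem exists_int_min_notMem (N : Seminorm ℝ (Fin q → ℝ)) (hN : ∀ x, N x = 0 → x = 0)
    (W : Submodule ℝ (Fin q → ℝ)) (hW : W ≠ ⊤) :
    ∃ v : Fin q → ℤ, (fun i => (v i : ℝ)) ∉ W ∧
      ∀ z : Fin q → ℤ, (fun i => (z i : ℝ)) ∉ W → N (fun i => (v i : ℝ)) ≤ N (fun i => (z i : ℝ)) := by
  classical
  -- some coordinate vector lies outside `W`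
  have hex : ∃ i₀ : Fin q, (Pi.single i₀ (1 : ℝ) : Fin q → ℝ) ∉ W := by
    by_contra h
    push Not at h
    apply hW
    refine Submodule.eq_top_iff'.mpr fun x => ?_
    have hx : x = ∑ i, x i • (Pi.single i (1 : ℝ) : Fin q → ℝ) := by
      ext j; simp [Finset.sum_apply, Pi.single_apply]
    rw [hx]
    exact Submodule.sum_mem _ fun i _ => Submodule.smul_mem _ _ (h i)
  obtain ⟨i₀, hi₀⟩ := hex
  let z₀ : Fin q → ℤ := Pi.single i₀ 1
  have hz₀ : (fun i => (z₀ i : ℝ)) = Pi.single i₀ (1 : ℝ) := by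
    ext i; simp [z₀, Pi.single_apply]
  have hz₀W : (fun i => (z₀ i : ℝ)) ∉ W := by rwa [hz₀]
  let C : Set (Fin q → ℤ) :=
    {z | (fun i => (z i : ℝ)) ∉ W ∧ N (fun i => (z i : ℝ)) ≤ N (fun i => (z₀ i : ℝ))}
  have hCfin : C.Finite := (finite_int_seminorm_le N hN _).subset fun z hz => hz.2
  have hCne : hCfin.toFinset.Nonempty := ⟨z₀, by simp [C, hz₀W]⟩
  obtain ⟨v, hv, hvmin⟩ := hCfin.toFinset.exists_min_image (fun z => N (fun i => (z i : ℝ))) hCne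
  simp only [Set.Finite.mem_toFinset] at hv hvmin
  refine ⟨v, hv.1, fun z hz => ?_⟩
  by_cases hle : N (fun i => (z i : ℝ)) ≤ N (fun i => (z₀ i : ℝ))
  · exact hvmin z ⟨hz, hle⟩
  · push Not at hle
    exact (hv.2.trans hle.le)

/-- **Existence of a directional system** for a norm `N` on `ℝ^q` and the lattice `ℤ^q` (the
greedy construction behind the successive minima: `v_k` is an integer vector of minimal norm
outside the real span of `v₀, …, v_{k−1}`): there are `v₀, …, v_{q−1} ∈ ℤ^q`, linearly
independent over `ℝ`, with `N(v₀) ≤ ⋯ ≤ N(v_{q−1})`, such that every integer vector of norm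
`< N(v_k)` lies in the real span of `v₀, …, v_{k−1}` (so `N(v_k) = λ_{k+1}`, the successive minima
of `B_N` w.r.t. `ℤ^q`; cf. Tao–Vu, proof of Thm 3.30). [cite: TaoVu2006, Theorem 3.30 (p. 160)] -/
theorem exists_directional_system (N : Seminorm ℝ (Fin q → ℝ)) (hN : ∀ x, N x = 0 → x = 0) :
    ∃ v : Fin q → Fin q → ℤ,
      LinearIndependent ℝ (fun k i => (v k i : ℝ)) ∧
      Monotone (fun k => N (fun i => (v k i : ℝ))) ∧
      ∀ k : Fin q, ∀ z : Fin q → ℤ, N (fun i => (z i : ℝ)) < N (fun i => (v k i : ℝ)) →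
        (fun i => (z i : ℝ)) ∈ Submodule.span ℝ ((fun k i => (v k i : ℝ)) '' {l | l < k}) := by
  classical
  let cast : (Fin q → ℤ) → (Fin q → ℝ) := fun z i => (z i : ℝ)
  -- spans of initial segments of an `ℕ`-indexed family
  let Wp : (ℕ → Fin q → ℤ) → ℕ → Submodule ℝ (Fin q → ℝ) :=
    fun v n => Submodule.span ℝ (((Finset.range n).image (cast ∘ v) : Finset (Fin q → ℝ)) : Set _)
  let Good : (ℕ → Fin q → ℤ) → ℕ → Prop := fun v n =>
    cast (v n) ∉ Wp v n ∧ ∀ z, cast z ∉ Wp v n → N (cast (v n)) ≤ N (cast z)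
  have Wp_congr : ∀ (v v' : ℕ → Fin q → ℤ) (n : ℕ), (∀ m < n, v m = v' m) → Wp v n = Wp v' n := by
    intro v v' n h
    simp only [Wp]
    congr 2
    refine Finset.image_congr fun m hm => ?_
    simp only [Finset.mem_coe, Finset.mem_range] at hm
    simp [Function.comp, h m hm]
  have Wp_ne_top : ∀ (v : ℕ → Fin q → ℤ) (n : ℕ), n < q → Wp v n ≠ ⊤ := by
    intro v n hn htop
    have h1 : finrank ℝ (Wp v n) ≤ n := by
      calc finrank ℝ (Wp v n) ≤ ((Finset.range n).image (cast ∘ v)).card :=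
            finrank_span_finset_le_card _
        _ ≤ (Finset.range n).card := Finset.card_image_le
        _ = n := Finset.card_range n
    rw [htop, finrank_top, Module.finrank_fin_fun] at h1
    omega
  -- the greedy construction
  have build : ∀ k : ℕ, k ≤ q → ∃ v : ℕ → Fin q → ℤ, ∀ n < k, Good v n := by
    intro k
    induction k with
    | zero => intro _; exact ⟨fun _ => 0, fun n hn => absurd hn (Nat.not_lt_zero n)⟩
    | succ k ih =>
      intro hk
      obtain ⟨v, hv⟩ := ih (by omega)
      obtain ⟨w, hw, hwmin⟩ := exists_int_min_notMem N hN (Wp v k) (Wp_ne_top v k (by omega))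
      refine ⟨Function.update v k w, fun n hn => ?_⟩
      have hWeq : Wp (Function.update v k w) n = Wp v n :=
        Wp_congr _ _ n fun m hm => Function.update_of_ne (by omega) _ _
      rcases Nat.lt_succ_iff_lt_or_eq.mp hn with hlt | rfl
      · have hvn : Function.update v k w n = v n := Function.update_of_ne (by omega) _ _
        simp only [Good, hWeq, hvn]
        exact hv n hlt
      · simp only [Good, hWeq, Function.update_self]
        exact ⟨hw, hwmin⟩
  obtain ⟨v, hv⟩ := build q le_rfl
  -- restrict to `Fin q`
  refine ⟨fun k => v k.val, ?_, ?_, ?_⟩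
  · -- linear independence
    rw [Fintype.linearIndependent_iff]
    intro g hg
    by_contra hne
    push Not at hne
    obtain ⟨k₁, hk₁⟩ := hne
    let S : Finset (Fin q) := Finset.univ.filter fun k => g k ≠ 0
    have hS : S.Nonempty := ⟨k₁, by simp [S, hk₁]⟩
    set k₀ := S.max' hS with hk₀
    have hk₀S : k₀ ∈ S := Finset.max'_mem S hS
    have hgk₀ : g k₀ ≠ 0 := by simpa [S] using hk₀S
    have hlt : ∀ k, g k ≠ 0 → k ≠ k₀ → k < k₀ := by
      intro k hk hne
      have : k ≤ k₀ := Finset.le_max' S k (by simp [S, hk])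
      exact lt_of_le_of_ne this hne
    -- `V k₀ ∈ Wp v k₀`
    have hmem : cast (v k₀.val) ∈ Wp v k₀.val := by
      have hsum := Finset.add_sum_erase Finset.univ (fun k => g k • (fun i => (v k.val i : ℝ)))
        (Finset.mem_univ k₀)
      rw [hg] at hsum
      have heq : cast (v k₀.val) = -(g k₀)⁻¹ • ∑ k ∈ Finset.univ.erase k₀,
          g k • (fun i => (v k.val i : ℝ)) := by
        have : g k₀ • cast (v k₀.val) = -∑ k ∈ Finset.univ.erase k₀,
            g k • (fun i => (v k.val i : ℝ)) := by
          rw [eq_neg_iff_add_eq_zero]; exact hsum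
        calc cast (v k₀.val) = (g k₀)⁻¹ • (g k₀ • cast (v k₀.val)) := by
              rw [smul_smul, inv_mul_cancel₀ hgk₀, one_smul]
          _ = (g k₀)⁻¹ • (-∑ k ∈ Finset.univ.erase k₀, g k • (fun i => (v k.val i : ℝ))) := by
              rw [this]
          _ = _ := by rw [smul_neg, neg_smul]
      rw [heq]
      refine Submodule.smul_mem _ _ (Submodule.sum_mem _ fun k hk => ?_)
      by_cases hgk : g k = 0
      · simp [hgk]
      · refine Submodule.smul_mem _ _ (Submodule.subset_span ?_)
        have hkk₀ : k < k₀ := hlt k hgk (Finset.ne_of_mem_erase hk)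
        simp only [Finset.coe_image, Finset.coe_range, Set.mem_image, Set.mem_Iio]
        exact ⟨k.val, hkk₀, rfl⟩
    exact (hv k₀.val k₀.2).1 hmem
  · -- monotonicity
    intro k k' hkk'
    rcases hkk'.lt_or_eq with hlt | heq
    · refine (hv k.val k.2).2 (v k'.val) fun hmem => (hv k'.val k'.2).1 ?_
      -- `Wp v k ≤ Wp v k'`
      refine Submodule.span_mono ?_ hmem
      intro x hx
      simp only [Finset.coe_image, Finset.coe_range, Set.mem_image, Set.mem_Iio] at hx ⊢
      obtain ⟨m, hm, rfl⟩ := hx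
      exact ⟨m, lt_trans hm hlt, rfl⟩
    · rw [heq]
  · -- the directional property
    intro k z hz
    have hmem : cast z ∈ Wp v k.val := by
      by_contra h
      exact absurd ((hv k.val k.2).2 z h) (not_le.mpr hz)
    have hset : (((Finset.range k.val).image (cast ∘ v) : Finset (Fin q → ℝ)) : Set _) =
        (fun k i => (v k.val i : ℝ)) '' {l : Fin q | l < k} := by
      ext x
      simp only [Finset.coe_image, Finset.coe_range, Set.mem_image, Set.mem_Iio, Set.mem_setOf_eq,
        Function.comp_apply]
      constructor
      · rintro ⟨m, hm, rfl⟩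
        exact ⟨⟨m, lt_trans hm k.2⟩, Fin.mk_lt_mk.mpr (by simpa using hm), rfl⟩
      · rintro ⟨l, hl, rfl⟩
        exact ⟨l.val, Fin.lt_def.mp hl, rfl⟩
    simp only [Wp] at hmem
    rwa [hset] at hmem

/-- **Minkowski's second theorem, upper bound, for `ℤ^q`** (Evertse–Győry, Thm 4.3.1), existence
form: for a norm `N` on `ℝ^q` there is a directional system `v₀, …, v_{q−1} ∈ ℤ^q` (as in
`exists_directional_system`) with `N(v₀) ⋯ N(v_{q−1}) · vol {N < 1} ≤ 2^q`.
[cite: EvertseGyory2015, Thm 4.3.1 (p. 70)] -/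
theorem exists_directional_system_prod_mul_volume_le (hq : 0 < q) (N : Seminorm ℝ (Fin q → ℝ))
    (hN : ∀ x, N x = 0 → x = 0) :
    ∃ v : Fin q → Fin q → ℤ,
      LinearIndependent ℝ (fun k i => (v k i : ℝ)) ∧
      Monotone (fun k => N (fun i => (v k i : ℝ))) ∧
      (∀ k : Fin q, ∀ z : Fin q → ℤ, N (fun i => (z i : ℝ)) < N (fun i => (v k i : ℝ)) →
        (fun i => (z i : ℝ)) ∈ Submodule.span ℝ ((fun k i => (v k i : ℝ)) '' {l | l < k})) ∧
      ENNReal.ofReal (∏ k, N (fun i => (v k i : ℝ))) * volume {x : Fin q → ℝ | N x < 1} ≤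
        2 ^ q := by
  obtain ⟨v, hli, hmono, hdir⟩ := exists_directional_system N hN
  exact ⟨v, hli, hmono, hdir,
    prod_seminorm_mul_volume_le_of_directional hq N hN _ hli hmono hdir⟩

end Literature.NumberTheory.DiophantineGeometry.Dioph

end
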